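import Mathlib
import HarnessLib

/-!
# The canonical predictable proxy (stub `stub_canonicalProxy`, line `gossip-forecast-ledger`)

Helper file (`--supports stmt-AtomisticToContinuum-14662`) proving the registered stub
`stub_canonicalProxy` (S4a) of the lead's skeleton for the crux
`Summit.AtomisticToContinuum.HydrodynamicLimit.Theses.OneFlightGossipEngine.KineticCurrentsWindowLDUniform`
(line `gossip-forecast-ledger`). The statement is pure probability (Mathlib only) and is spelled
exactly as registered.

**Statement.** For a probability measure `P`, sub-σ-algebras `ℱ k ≤ mΩ`, forecasts
`f_k := P[X | ℱ k]` with increments `d_k := f_{k+1} − f_k` such that `e^{α d_k} ∈ L¹(P)`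
(`α > 0`), the *canonical proxy*
`V_k := (2/α²) · max (0, log g_k)`, `g_k := P[e^{α d_k} | ℱ k]`,
is nonnegative, `ℱ k`-measurable, and satisfies the one-step exponential supermartingale bound
`∫⁻_s exp (α d_k − α² V_k / 2) dP ≤ P s` for every `s ∈ ℱ k`.

**Proof.** Nonnegativity and measurability are immediate (`stronglyMeasurable_condExp`,
`Measurable.log`, `Measurable.max`). For the bound, `α d_k − α² V_k / 2 = α d_k − max (0, log g_k)`,
so the integrand is `e^{α d_k} · h` with the `ℱ k`-measurable weight
`h := exp (−max (0, log g_k)) ∈ (0, 1]`. Converting to a Bochner integral and pulling the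
bounded `ℱ k`-measurable factor out of the conditional expectation
(`setIntegral_condExp`, `condExp_stronglyMeasurable_mul_of_bound`) gives
`∫_s e^{α d_k} h dP = ∫_s h · g_k dP`, and `h · g_k ≤ 1` pointwise because
`g ≤ exp (max (0, log g))` for every real `g`. Hence the integral is at most `P s`.

Nothing here depends on the hard-sphere model; no named facts are used.
-/

noncomputable section

open MeasureTheory Set Filter InformationTheory
open scoped ENNReal Topology Classical ProbabilityTheory

namespace Summit.AtomisticToContinuum.HydrodynamicLimit.Theorems.KineticCurrentsWindowLDUniformGossip

namespace CanonicalProxy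

/-- Every real `g` satisfies `g ≤ exp (max 0 (log g))`: for `g ≤ 0` the right-hand side is
positive, and for `g > 0` one has `g = exp (log g)` and `exp` is monotone. -/
theorem le_exp_max_zero_log (g : ℝ) : g ≤ Real.exp (max 0 (Real.log g)) := by
  rcases le_or_gt g 0 with h | h
  · exact h.trans (Real.exp_pos _).le
  · calc g = Real.exp (Real.log g) := (Real.exp_log h).symm
      _ ≤ Real.exp (max 0 (Real.log g)) := Real.exp_le_exp.2 (le_max_right _ _)

/-- The normalising weight `exp (-max 0 (log g))` times `g` is at most `1`. -/
theorem exp_neg_max_zero_log_mul_le_one (g : ℝ) :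
    Real.exp (-max 0 (Real.log g)) * g ≤ 1 := by
  rw [Real.exp_neg, inv_mul_le_iff₀ (Real.exp_pos _), mul_one]
  exact le_exp_max_zero_log g

/-- The normalising weight `exp (-max 0 (log g))` is at most `1`. -/
theorem exp_neg_max_zero_log_le_one (g : ℝ) : Real.exp (-max 0 (Real.log g)) ≤ 1 :=
  Real.exp_le_one_iff.2 (neg_nonpos.2 (le_max_left _ _))

/-- Measurability of the normalising weight `ω ↦ exp (-max 0 (log (g ω)))` with respect to any
σ-algebra for which `g` is measurable. -/
theorem measurable_exp_neg_max_zero_log {Ω : Type*} {m : MeasurableSpace Ω} {g : Ω → ℝ}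
    (hg : Measurable[m] g) : Measurable[m] fun ω => Real.exp (-max 0 (Real.log (g ω))) :=
  (measurable_const.max hg.log).neg.exp

/-- Measurability of the canonical proxy `ω ↦ c * max 0 (log (g ω))` with respect to any
σ-algebra for which `g` is measurable. -/
theorem measurable_const_mul_max_zero_log {Ω : Type*} {m : MeasurableSpace Ω} {g : Ω → ℝ}
    (hg : Measurable[m] g) (c : ℝ) : Measurable[m] fun ω => c * max 0 (Real.log (g ω)) :=
  (measurable_const.max hg.log).const_mul c

/-- The algebra of the exponent: with `V = (2/α²) M`, `α a − α² V / 2 = α a − M`, so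
`exp (α a − α² V / 2) = exp (α a) · exp (−M)` (`α ≠ 0`). -/
theorem exp_sub_sq_mul_proxy (α a M : ℝ) (hα : α ≠ 0) :
    Real.exp (α * a - α ^ 2 * (2 / α ^ 2 * M) / 2) = Real.exp (α * a) * Real.exp (-M) := by
  rw [← Real.exp_add]
  congr 1
  field_simp
  ring

/-- **Pull-out domination (abstract form).** Let `m ≤ mΩ`, `F ≥ 0` integrable, and let `h` be an
`m`-measurable weight with `0 ≤ h ≤ 1` and `h · P[F | m] ≤ 1` pointwise. Then
`∫⁻_s ofReal (F h) dP ≤ P s` for every `m`-measurable `s`: indeed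
`∫_s F h dP = ∫_s P[h F | m] dP = ∫_s h · P[F | m] dP ≤ ∫_s 1 dP = P s`
(`setIntegral_condExp`, `condExp_stronglyMeasurable_mul_of_bound`). -/
theorem setLIntegral_ofReal_mul_le {Ω : Type*} {m mΩ : MeasurableSpace Ω} {P : Measure Ω}
    [IsFiniteMeasure P] (hm : m ≤ mΩ) {F h : Ω → ℝ} (hF : Integrable F P) (hF0 : ∀ ω, 0 ≤ F ω)
    (hhm : Measurable[m] h) (hh0 : ∀ ω, 0 ≤ h ω) (hh1 : ∀ ω, h ω ≤ 1)
    (hdom : ∀ ω, h ω * (P[F|m]) ω ≤ 1) {s : Set Ω} (hs : MeasurableSet[m] s) :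
    ∫⁻ ω in s, ENNReal.ofReal (F ω * h ω) ∂P ≤ P s := by
  have hhsm : StronglyMeasurable[m] h := hhm.stronglyMeasurable
  have hh_bound : ∀ᵐ ω ∂P, ‖h ω‖ ≤ 1 :=
    ae_of_all _ fun ω => by
      rw [Real.norm_eq_abs, abs_of_nonneg (hh0 ω)]
      exact hh1 ω
  have hhasm : AEStronglyMeasurable h P := (hhsm.mono hm).aestronglyMeasurable
  -- `h * F` and `h * P[F|m]` are integrable (bounded measurable factor times integrable)
  have hhF : Integrable (h * F) P := hF.bdd_mul hhasm hh_bound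
  have hGi : Integrable (P[F|m]) P := integrable_condExp
  have hhG : Integrable (h * P[F|m]) P := hGi.bdd_mul hhasm hh_bound
  -- the pull-out property of the conditional expectation
  have hpull : P[h * F|m] =ᵐ[P] h * P[F|m] :=
    condExp_stronglyMeasurable_mul_of_bound hm hhsm hF 1 hh_bound
  have hreal : ∫ ω in s, (h * F) ω ∂P ≤ P.real s := by
    calc ∫ ω in s, (h * F) ω ∂P = ∫ ω in s, (P[h * F|m]) ω ∂P :=
          (setIntegral_condExp hm hhF hs).symm
      _ = ∫ ω in s, (h * P[F|m]) ω ∂P :=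
          setIntegral_congr_ae (hm s hs) (hpull.mono fun ω hω _ => hω)
      _ ≤ ∫ ω in s, (fun _ => (1 : ℝ)) ω ∂P :=
          setIntegral_mono hhG.integrableOn (integrable_const (1 : ℝ)).integrableOn
            fun ω => hdom ω
      _ = P.real s := by rw [setIntegral_const, smul_eq_mul, mul_one]
  calc ∫⁻ ω in s, ENNReal.ofReal (F ω * h ω) ∂P
      = ∫⁻ ω in s, ENNReal.ofReal ((h * F) ω) ∂P := by
        refine lintegral_congr fun ω => ?_
        rw [Pi.mul_apply, mul_comm]
    _ = ENNReal.ofReal (∫ ω in s, (h * F) ω ∂P) :=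
        (ofReal_integral_eq_lintegral_ofReal hhF.integrableOn
          (ae_of_all _ fun ω => mul_nonneg (hh0 ω) (hF0 ω))).symm
    _ ≤ ENNReal.ofReal (P.real s) := ENNReal.ofReal_le_ofReal hreal
    _ = P s := ofReal_measureReal (measure_ne_top P s)

/-- **Pull-out domination (canonical weight).** For `m ≤ mΩ` and an integrable `F ≥ 0`, the
canonical weight `h := exp (−max (0, log P[F | m]))` satisfies `∫⁻_s ofReal (F h) dP ≤ P s` for
every `m`-measurable `s` (apply `setLIntegral_ofReal_mul_le`; `h · P[F|m] ≤ 1` by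
`exp_neg_max_zero_log_mul_le_one`). -/
theorem setLIntegral_ofReal_mul_canonical_le {Ω : Type*} {m mΩ : MeasurableSpace Ω}
    {P : Measure Ω} [IsFiniteMeasure P] (hm : m ≤ mΩ) {F : Ω → ℝ} (hF : Integrable F P)
    (hF0 : ∀ ω, 0 ≤ F ω) {s : Set Ω} (hs : MeasurableSet[m] s) :
    ∫⁻ ω in s, ENNReal.ofReal (F ω * Real.exp (-max 0 (Real.log ((P[F|m]) ω)))) ∂P ≤ P s :=
  setLIntegral_ofReal_mul_le hm hF hF0
    (measurable_exp_neg_max_zero_log stronglyMeasurable_condExp.measurable)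
    (fun _ => (Real.exp_pos _).le) (fun _ => exp_neg_max_zero_log_le_one _)
    (fun _ => exp_neg_max_zero_log_mul_le_one _) hs

end CanonicalProxy

/-- S4a — the canonical predictable proxy `V_k = (2/α²)·max(0, log P[e^{α d_k} | ℱ k])` of a forecast martingale is nonnegative, adapted, and dominates the conditional MGF of the increments in set-integral form (registered stub `stub_canonicalProxy` of line `gossip-forecast-ledger`, crux stmt-AtomisticToContinuum-14662). [folklore] -/
theorem stub_canonicalProxy :
    ∀ (Ω : Type) [mΩ : MeasurableSpace Ω] (P : Measure Ω) [IsProbabilityMeasure P]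
      (ℱ : ℕ → MeasurableSpace Ω), (∀ n, ℱ n ≤ mΩ) →
      ∀ (X : Ω → ℝ) (α : ℝ), 0 < α →
      (∀ k, Integrable (fun ω => Real.exp (α * ((P[X|ℱ (k + 1)]) ω - (P[X|ℱ k]) ω))) P) →
      let V : ℕ → Ω → ℝ := fun k ω =>
        2 / α ^ 2 * max 0 (Real.log ((P[fun ω => Real.exp (α * ((P[X|ℱ (k + 1)]) ω - (P[X|ℱ k]) ω))|ℱ k]) ω))
      (∀ k ω, 0 ≤ V k ω) ∧ (∀ k, Measurable[ℱ k] (V k)) ∧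
        ∀ (k : ℕ) (s : Set Ω), MeasurableSet[ℱ k] s →
          ∫⁻ ω in s, ENNReal.ofReal (Real.exp (α * ((P[X|ℱ (k + 1)]) ω - (P[X|ℱ k]) ω) - α ^ 2 * V k ω / 2)) ∂P
            ≤ P s := by
  intro Ω mΩ P _ ℱ hℱ X α hα hint V
  simp only [V]
  refine ⟨fun k ω => ?_, fun k => ?_, fun k s hs => ?_⟩
  · exact mul_nonneg (div_nonneg zero_le_two (sq_nonneg α)) (le_max_left _ _)
  · exact CanonicalProxy.measurable_const_mul_max_zero_log stronglyMeasurable_condExp.measurable _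
  · refine (lintegral_congr fun ω => ?_).trans_le
      (CanonicalProxy.setLIntegral_ofReal_mul_canonical_le (hℱ k) (hint k)
        (fun _ => (Real.exp_pos _).le) hs)
    rw [CanonicalProxy.exp_sub_sq_mul_proxy _ _ _ hα.ne']

end Summit.AtomisticToContinuum.HydrodynamicLimit.Theorems.KineticCurrentsWindowLDUniformGossip

end
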